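import Summits.ValiantsHypothesis.ValiantsHypothesis.Theorems.SymPencilPerFourHessianMinors
import Summits.ValiantsHypothesis.ValiantsHypothesis.Theorems.SymPencilPerFourCrossPairNoJoint

/-!
# Route `SymPencil` — the Kronecker form on a cross: `rank Hess per_4 (y) ≤ 8` for `y ∈ X₃₃`
# forces `(a₀a₁a₂)(b₀b₁b₂) = 0` (input of leaf 4 `stub_crossFilter` of
# `Cruxes/SdcSuperquadratic/Lines/sing_six_classification.lean`; `--supports`
# stmt-ValiantsHypothesis-5674 `SdcSuperquadratic`; rung currency only, nothing here bears on `VP ≠ VNP`)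

For `y` in the cross `X₃₃` (support in row `3 ∪` column `3`) write `a_j = y_{3j}`, `b_i = y_{i3}`
(`i, j < 3`).  For a base point `u` supported on the `3 × 3` block `{0,1,2}²` one has EXACTLY
`per_4 (u + s y) = s · y₃₃ per₃(u) + s² · Q_y(u)` with
`Q_y(u) = Σ_{i,j<3} b_i a_j · per₂(u; rows ≠ i, 3; cols ≠ j, 3)` (`eval_cross_block`), i.e. the
quadratic form of the Kronecker product `B(b) ⊗ A(a)` of the two zero-diagonal `3 × 3` pairings
`A(a)_{jj'} = a_{j''}`, `B(b)_{ii'} = b_{i''}` (`{j,j',j''} = {0,1,2}`), of rank `rank A · rank B`.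

**Theorem** (`prod_arms_eq_zero_of_sum_sq_swap`, characteristic `0`).  If the `s²`-coefficient of
`per_4 (u + s y)` is a combination of `< 9` squares of linear functionals of `u` (in particular a
per-direction family of `≤ 6` squares, `PerDirSix`), then `(a₀ a₁ a₂) · (b₀ b₁ b₂) = 0`.
Proof (mechanism of `SymPencilPerFourBlockElemRankSix`): the functionals have a common kernel
vector `n ≠ 0` on the nine block cells; it is `Q_y`-orthogonal to every block cell, i.e.
`B N A = 0` for the `3 × 3` matrix `N` of `n`; when both arm products are non-zero the pairings
`A, B` have trivial kernel (`SymPencilPerFourHessianMinors.eq_zero_of_pairing₃`), so `N = 0`.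

Use (`SymPencilPerFourCrossFilter`): on a `6`-dimensional `W ⊆ X_{lc}` with `PerDirSix` the
product of the six arm coordinates vanishes identically, so one arm coordinate vanishes on `W` and
`W = X_{lc} ∩ {x_e = 0}` — the `V×`-type of the V-side LIST of cell `(10,6,6)`.  Honest framing: a
lemma; `27 ≤ sdc(per₄) ≤ 29` unchanged, stmt-5674 open, `VP ≠ VNP` not moved, no summit statement
is proved here.  No definitions, no named facts. [folklore]
-/

noncomputable section

-- single-conjunct layout: Sub = Summit, duplicated namespace component intended
set_option linter.dupNamespace false

namespace Summit.ValiantsHypothesis.ValiantsHypothesis.Theorems.SymPencilPerFourCrossKronecker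

open Matrix MvPolynomial Finset Module
open Literature.Computability.AlgebraicComplexity
open Summit.ValiantsHypothesis.ValiantsHypothesis.Theorems.SymPencilPerFourHessianMinors
open Summit.ValiantsHypothesis.ValiantsHypothesis.Theorems.SymPencilPerFourCrossPairNoJoint

variable {K : Type*} [Field K]

/-- The nine block cells `{0,1,2}²` as a linear parametrisation of base points. [folklore] -/
theorem exists_blockEmbedding :
    ∃ U : (Fin 3 × Fin 3 → K) →ₗ[K] (Fin 4 × Fin 4 → K), ∀ (w : Fin 3 × Fin 3 → K) (p : Fin 4 × Fin 4),
      U w p = (if p = (0, 0) then w (0, 0) else if p = (0, 1) then w (0, 1)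
        else if p = (0, 2) then w (0, 2) else if p = (1, 0) then w (1, 0)
        else if p = (1, 1) then w (1, 1) else if p = (1, 2) then w (1, 2)
        else if p = (2, 0) then w (2, 0) else if p = (2, 1) then w (2, 1)
        else if p = (2, 2) then w (2, 2) else 0) := by
  classical
  let U : (Fin 3 × Fin 3 → K) →ₗ[K] (Fin 4 × Fin 4 → K) :=
    { toFun := fun w p => if p = (0, 0) then w (0, 0) else if p = (0, 1) then w (0, 1)
        else if p = (0, 2) then w (0, 2) else if p = (1, 0) then w (1, 0)
        else if p = (1, 1) then w (1, 1) else if p = (1, 2) then w (1, 2)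
        else if p = (2, 0) then w (2, 0) else if p = (2, 1) then w (2, 1)
        else if p = (2, 2) then w (2, 2) else 0
      map_add' := fun a b => by
        funext p
        by_cases h00 : p = (0, 0); · simp [h00]
        by_cases h01 : p = (0, 1); · simp [h01]
        by_cases h02 : p = (0, 2); · simp [h02]
        by_cases h10 : p = (1, 0); · simp [h10]
        by_cases h11 : p = (1, 1); · simp [h11]
        by_cases h12 : p = (1, 2); · simp [h12]
        by_cases h20 : p = (2, 0); · simp [h20]
        by_cases h21 : p = (2, 1); · simp [h21]
        by_cases h22 : p = (2, 2); · simp [h22]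
        simp [h00, h01, h02, h10, h11, h12, h20, h21, h22]
      map_smul' := fun a n => by
        funext p
        by_cases h00 : p = (0, 0); · simp [h00]
        by_cases h01 : p = (0, 1); · simp [h01]
        by_cases h02 : p = (0, 2); · simp [h02]
        by_cases h10 : p = (1, 0); · simp [h10]
        by_cases h11 : p = (1, 1); · simp [h11]
        by_cases h12 : p = (1, 2); · simp [h12]
        by_cases h20 : p = (2, 0); · simp [h20]
        by_cases h21 : p = (2, 1); · simp [h21]
        by_cases h22 : p = (2, 2); · simp [h22]
        simp [h00, h01, h02, h10, h11, h12, h20, h21, h22] }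
  exact ⟨U, fun _ _ => rfl⟩

/-- **`per_4` on (block base point) `+ s ·` (cross element)**: for `u = U w` supported on the block
`{0,1,2}²` and `y ∈ X₃₃`,
`per_4 (U w + s y) = s · y₃₃ per₃(w) + s² · Σ_{i,j<3} y_{i3} y_{3j} per₂(w; {i}ᶜ, {j}ᶜ)`. [folklore] -/
theorem eval_cross_block (y : Fin 4 × Fin 4 → K) (hy : ∀ i j : Fin 4, i ≠ 3 → j ≠ 3 → y (i, j) = 0)
    (U : (Fin 3 × Fin 3 → K) →ₗ[K] (Fin 4 × Fin 4 → K))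
    (hU : ∀ (w : Fin 3 × Fin 3 → K) (p : Fin 4 × Fin 4),
      U w p = (if p = (0, 0) then w (0, 0) else if p = (0, 1) then w (0, 1)
        else if p = (0, 2) then w (0, 2) else if p = (1, 0) then w (1, 0)
        else if p = (1, 1) then w (1, 1) else if p = (1, 2) then w (1, 2)
        else if p = (2, 0) then w (2, 0) else if p = (2, 1) then w (2, 1)
        else if p = (2, 2) then w (2, 2) else 0))
    (w : Fin 3 × Fin 3 → K) (s : K) :
    eval (U w + s • y) (perPoly (Fin 4) K) =
      0 + s * (y (3, 3) * (w (0, 0) * (w (1, 1) * w (2, 2) + w (1, 2) * w (2, 1)) +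
        w (0, 1) * (w (1, 0) * w (2, 2) + w (1, 2) * w (2, 0)) +
        w (0, 2) * (w (1, 0) * w (2, 1) + w (1, 1) * w (2, 0)))) +
      s ^ 2 * (y (0, 3) * y (3, 0) * (w (1, 1) * w (2, 2) + w (1, 2) * w (2, 1)) +
        y (0, 3) * y (3, 1) * (w (1, 0) * w (2, 2) + w (1, 2) * w (2, 0)) +
        y (0, 3) * y (3, 2) * (w (1, 0) * w (2, 1) + w (1, 1) * w (2, 0)) +
        y (1, 3) * y (3, 0) * (w (0, 1) * w (2, 2) + w (0, 2) * w (2, 1)) +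
        y (1, 3) * y (3, 1) * (w (0, 0) * w (2, 2) + w (0, 2) * w (2, 0)) +
        y (1, 3) * y (3, 2) * (w (0, 0) * w (2, 1) + w (0, 1) * w (2, 0)) +
        y (2, 3) * y (3, 0) * (w (0, 1) * w (1, 2) + w (0, 2) * w (1, 1)) +
        y (2, 3) * y (3, 1) * (w (0, 0) * w (1, 2) + w (0, 2) * w (1, 0)) +
        y (2, 3) * y (3, 2) * (w (0, 0) * w (1, 1) + w (0, 1) * w (1, 0))) := by
  obtain ⟨f01, f02, f10, f12, f20, f21, f30, f31, f32⟩ :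
      (((0 : Fin 4) = 1) = False) ∧ (((0 : Fin 4) = 2) = False) ∧
      (((1 : Fin 4) = 0) = False) ∧ (((1 : Fin 4) = 2) = False) ∧
      (((2 : Fin 4) = 0) = False) ∧ (((2 : Fin 4) = 1) = False) ∧
      (((3 : Fin 4) = 0) = False) ∧ (((3 : Fin 4) = 1) = False) ∧ (((3 : Fin 4) = 2) = False) := by
    refine ⟨?_, ?_, ?_, ?_, ?_, ?_, ?_, ?_, ?_⟩ <;> decide
  have y00 := hy 0 0 (by decide) (by decide)
  have y01 := hy 0 1 (by decide) (by decide)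
  have y02 := hy 0 2 (by decide) (by decide)
  have y10 := hy 1 0 (by decide) (by decide)
  have y11 := hy 1 1 (by decide) (by decide)
  have y12 := hy 1 2 (by decide) (by decide)
  have y20 := hy 2 0 (by decide) (by decide)
  have y21 := hy 2 1 (by decide) (by decide)
  have y22 := hy 2 2 (by decide) (by decide)
  rw [eval_perPoly, Matrix.permanent_fin_four_row]
  simp only [Matrix.of_apply, Pi.add_apply, Pi.smul_apply, smul_eq_mul, hU, Prod.mk.injEq,
    f01, f02, f10, f12, f20, f21, f30, f31, f32, and_true, and_false,
    if_true, if_false, y00, y01, y02, y10, y11, y12, y20, y21, y22]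
  ring

/-- **The Kronecker form on the cross has rank `9` when both arm products are non-zero**: a
family of `< 9` squares for the `s²`-coefficient of `per_4 (u + s y)`, `y ∈ X₃₃`, forces
`(y₃₀ y₃₁ y₃₂)(y₀₃ y₁₃ y₂₃) = 0`.  See the module docstring. [folklore] -/
theorem prod_arms_eq_zero_of_sum_sq_swap [CharZero K] {ι : Type*} [Fintype ι]
    (hι : Fintype.card ι < 9) (y : Fin 4 × Fin 4 → K)
    (hy : ∀ i j : Fin 4, i ≠ 3 → j ≠ 3 → y (i, j) = 0) (c : ι → K)
    (Λ : ι → ((Fin 4 × Fin 4 → K) →ₗ[K] K))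
    (hfam : ∀ u : Fin 4 × Fin 4 → K, ∃ e₀ e₁ : K, ∀ s : K,
      eval (u + s • y) (perPoly (Fin 4) K) = e₀ + s * e₁ + s ^ 2 * ∑ k, c k * (Λ k u) ^ 2) :
    y (3, 0) * y (3, 1) * y (3, 2) * (y (0, 3) * y (1, 3) * y (2, 3)) = 0 := by
  classical
  by_contra hne
  have ha : y (3, 2) * y (3, 1) * y (3, 0) ≠ 0 := by
    intro h; apply hne; linear_combination (y (0, 3) * y (1, 3) * y (2, 3)) * h
  have hb : y (2, 3) * y (1, 3) * y (0, 3) ≠ 0 := by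
    intro h; apply hne; linear_combination (y (3, 0) * y (3, 1) * y (3, 2)) * h
  obtain ⟨f01, f02, f10, f12, f20, f21⟩ :
      (((0 : Fin 3) = 1) = False) ∧ (((0 : Fin 3) = 2) = False) ∧
      (((1 : Fin 3) = 0) = False) ∧ (((1 : Fin 3) = 2) = False) ∧
      (((2 : Fin 3) = 0) = False) ∧ (((2 : Fin 3) = 1) = False) := by
    refine ⟨?_, ?_, ?_, ?_, ?_, ?_⟩ <;> decide
  -- (A) the `s²`-coefficient on block base points
  obtain ⟨U, hU⟩ := exists_blockEmbedding (K := K)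
  obtain ⟨Q, hQ⟩ : ∃ Q : (Fin 3 × Fin 3 → K) → K, ∀ w, Q w =
      y (0, 3) * y (3, 0) * (w (1, 1) * w (2, 2) + w (1, 2) * w (2, 1)) +
        y (0, 3) * y (3, 1) * (w (1, 0) * w (2, 2) + w (1, 2) * w (2, 0)) +
        y (0, 3) * y (3, 2) * (w (1, 0) * w (2, 1) + w (1, 1) * w (2, 0)) +
        y (1, 3) * y (3, 0) * (w (0, 1) * w (2, 2) + w (0, 2) * w (2, 1)) +
        y (1, 3) * y (3, 1) * (w (0, 0) * w (2, 2) + w (0, 2) * w (2, 0)) +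
        y (1, 3) * y (3, 2) * (w (0, 0) * w (2, 1) + w (0, 1) * w (2, 0)) +
        y (2, 3) * y (3, 0) * (w (0, 1) * w (1, 2) + w (0, 2) * w (1, 1)) +
        y (2, 3) * y (3, 1) * (w (0, 0) * w (1, 2) + w (0, 2) * w (1, 0)) +
        y (2, 3) * y (3, 2) * (w (0, 0) * w (1, 1) + w (0, 1) * w (1, 0)) := ⟨_, fun _ => rfl⟩
  -- (B) coefficient extraction
  have hB : ∀ w : Fin 3 × Fin 3 → K, ∑ k, c k * (Λ k (U w)) ^ 2 = Q w := by
    intro w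
    obtain ⟨e₀, e₁, he⟩ := hfam (U w)
    have hA := eval_cross_block y hy U hU w
    rw [hQ]
    exact coeff_two_eq_of_forall₂ (fun s => (he s).symm.trans (hA s))
  -- (C) a common-kernel vector of the functionals on the nine block cells
  let M : (Fin 3 × Fin 3 → K) →ₗ[K] (ι → K) := LinearMap.pi fun k => (Λ k).comp U
  have hM : ∀ n k, M n k = Λ k (U n) := fun n k => rfl
  have hker : LinearMap.ker M ≠ ⊥ := LinearMap.ker_ne_bot_of_finrank_lt (by
    rw [Module.finrank_fintype_fun_eq_card, Module.finrank_fintype_fun_eq_card,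
      Fintype.card_prod, Fintype.card_fin]
    omega)
  obtain ⟨n, hn, hn0⟩ := Submodule.exists_mem_ne_zero_of_ne_bot hker
  have hΛ0 : ∀ k, Λ k (U n) = 0 := fun k => by
    have := congr_fun (LinearMap.mem_ker.1 hn) k
    rwa [hM] at this
  -- (D) `Q (n + e) = Q e` for every `e`, and `Q n = 0`
  have hQn : Q n = 0 := by
    rw [← hB n]
    exact Finset.sum_eq_zero fun k _ => by rw [hΛ0 k]; ring
  have hQadd : ∀ e : Fin 3 × Fin 3 → K, Q (n + e) = Q e := by
    intro e
    rw [← hB (n + e), ← hB e]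
    exact Finset.sum_congr rfl fun k _ => by rw [map_add, map_add, hΛ0 k, zero_add]
  obtain ⟨E, hE⟩ : ∃ E : Fin 3 × Fin 3 → (Fin 3 × Fin 3 → K), ∀ P p, E P p = if p = P then 1 else 0 :=
    ⟨fun P p => if p = P then 1 else 0, fun _ _ => rfl⟩
  -- the nine relations `Φ(n, E_P) = 0`, i.e. `(B N A)_P = 0`
  have r00 := hQadd (E (0, 0))
  have r01 := hQadd (E (0, 1))
  have r02 := hQadd (E (0, 2))
  have r10 := hQadd (E (1, 0))
  have r11 := hQadd (E (1, 1))
  have r12 := hQadd (E (1, 2))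
  have r20 := hQadd (E (2, 0))
  have r21 := hQadd (E (2, 1))
  have r22 := hQadd (E (2, 2))
  simp only [hQ, hE, Pi.add_apply, Prod.mk.injEq, f01, f02, f10, f12, f20, f21, and_true,
    and_false, if_true, if_false] at r00 r01 r02 r10 r11 r12 r20 r21 r22 hQn
  -- rows of `B N`: `m_{i'j} = Σ_{i ≠ i'} b_{i*} n_{ij}`
  -- row `i' = 0`: `m_{0j} = b₂ n_{1j} + b₁ n_{2j}`
  obtain ⟨m00, m01, m02⟩ := eq_zero_of_pairing₃ ha
    (z₀ := y (2, 3) * n (1, 0) + y (1, 3) * n (2, 0))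
    (z₁ := y (2, 3) * n (1, 1) + y (1, 3) * n (2, 1))
    (z₂ := y (2, 3) * n (1, 2) + y (1, 3) * n (2, 2))
    (by linear_combination r00 - hQn) (by linear_combination r01 - hQn)
    (by linear_combination r02 - hQn)
  -- row `i' = 1`: `m_{1j} = b₂ n_{0j} + b₀ n_{2j}`
  obtain ⟨m10, m11, m12⟩ := eq_zero_of_pairing₃ ha
    (z₀ := y (2, 3) * n (0, 0) + y (0, 3) * n (2, 0))
    (z₁ := y (2, 3) * n (0, 1) + y (0, 3) * n (2, 1))
    (z₂ := y (2, 3) * n (0, 2) + y (0, 3) * n (2, 2))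
    (by linear_combination r10 - hQn) (by linear_combination r11 - hQn)
    (by linear_combination r12 - hQn)
  -- row `i' = 2`: `m_{2j} = b₁ n_{0j} + b₀ n_{1j}`
  obtain ⟨m20, m21, m22⟩ := eq_zero_of_pairing₃ ha
    (z₀ := y (1, 3) * n (0, 0) + y (0, 3) * n (1, 0))
    (z₁ := y (1, 3) * n (0, 1) + y (0, 3) * n (1, 1))
    (z₂ := y (1, 3) * n (0, 2) + y (0, 3) * n (1, 2))
    (by linear_combination r20 - hQn) (by linear_combination r21 - hQn)
    (by linear_combination r22 - hQn)
  -- columns of `N`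
  obtain ⟨n00, n10, n20⟩ := eq_zero_of_pairing₃ hb (z₀ := n (0, 0)) (z₁ := n (1, 0))
    (z₂ := n (2, 0)) (by linear_combination m00) (by linear_combination m10)
    (by linear_combination m20)
  obtain ⟨n01, n11, n21⟩ := eq_zero_of_pairing₃ hb (z₀ := n (0, 1)) (z₁ := n (1, 1))
    (z₂ := n (2, 1)) (by linear_combination m01) (by linear_combination m11)
    (by linear_combination m21)
  obtain ⟨n02, n12, n22⟩ := eq_zero_of_pairing₃ hb (z₀ := n (0, 2)) (z₁ := n (1, 2))
    (z₂ := n (2, 2)) (by linear_combination m02) (by linear_combination m12)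
    (by linear_combination m22)
  apply hn0
  funext p
  obtain ⟨i, j⟩ := p
  fin_cases i <;> fin_cases j
  · exact n00
  · exact n01
  · exact n02
  · exact n10
  · exact n11
  · exact n12
  · exact n20
  · exact n21
  · exact n22

/-- **Product form on a subspace**: if every `y` of a subspace `W` of the cross `X₃₃` has the
swapped property with `< 9` squares, the product of the six arm coordinates vanishes on `W`.
[folklore] -/
theorem prod_arms_eq_zero_on [CharZero K] {ι : Type*} [Fintype ι] (hι : Fintype.card ι < 9)
    (W : Submodule K (Fin 4 × Fin 4 → K))
    (hX : ∀ x ∈ W, ∀ i j : Fin 4, i ≠ 3 → j ≠ 3 → x (i, j) = 0)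
    (hW : ∀ y ∈ W, ∃ (c : ι → K) (Λ : ι → ((Fin 4 × Fin 4 → K) →ₗ[K] K)),
      ∀ u : Fin 4 × Fin 4 → K, ∃ e₀ e₁ : K, ∀ s : K,
        eval (u + s • y) (perPoly (Fin 4) K) = e₀ + s * e₁ + s ^ 2 * ∑ k, c k * (Λ k u) ^ 2) :
    ∀ y ∈ W, y (3, 0) * y (3, 1) * y (3, 2) * (y (0, 3) * y (1, 3) * y (2, 3)) = 0 := by
  intro y hy
  obtain ⟨c, Λ, h⟩ := hW y hy
  exact prod_arms_eq_zero_of_sum_sq_swap hι y (hX y hy) c Λ h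

end Summit.ValiantsHypothesis.ValiantsHypothesis.Theorems.SymPencilPerFourCrossKronecker

end
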